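import Summits.AnomalousDissipation.AnomalousDissipation.Theorems.SolenoidalFractalHomogenisationLagrangianStepVmodSSRegimesD
import HarnessLib

/-!
# K1L_D (stmt-AnomalousDissipation-27980): (V_mod) flat stage, block (fs) — THE INTERMEDIATE ROW FOR A FAST CLASS DATUM in the allowance
# currency of `BlockBound`: coarse labels within scale (`u = R·P ≤ 1`), windows `P ≤ τ`, `Rτ ≤ 2`, carrier phase 0 (certifier's table §4 (fs),
# the window range between `…VmodFsPeriodWindow` (`τ ≤ P`) and the grid iteration `…VmodFsIterRow` (`Rτ ≥ 2`))
(helper; `--supports 27980 --as helper`; prover ad-k1loc-p3 g10; tool = p1 g15's phase-anchored leak lemma `VmodGen.norm_fc_slow_le_of_fast`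
(`…VmodLeakSlow`) + the scalar envelopes of `…VmodSSRegimesD` (`cL ≤ cL^* ≤ cLp·√u`).)

Notation as in `…VmodSSRegimes*` (`R = 8π²·loT·|ℓ|²`, `P = M·W.period/ν`, `u = RP`, `τ = t − s`, `y = Rτ`, `D₀ = 8π²(lo/Λ)M·Wp·c`,
`E₁ = 9k²/(2π⁴(lo/Λ)²c)`, `cLp = 12k·e^{E₁}/(π²(lo/Λ)√D₀)`).
* `mid_charge_fast` — `cLp·√u ≤ C₁·(u/y)^e·√(½·min 1 y)` for `2cLp ≤ C₁`, `0 < u ≤ y ≤ 2`, `e ≤ ½`;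
* **`leak_le_alw_of_scale_mid_fast`** — for a weakly divergence-free FAST member `v` of the class pair of a slow label `ℓ` (`ℓ ∈ freqBall Lb`,
  `2Lb < n`) and a window at carrier phase 0 with `P ≤ τ`, `Rτ ≤ 2`, `u ≤ 1`:
  `‖𝓕(U s t v)(ℓ)‖ ≤ (C₁(C₁(ν^e + (⌈K/ν⌉₊/n)^e) + (min 1 (P/τ))^e)) · √(dW(τ, ℓ)) · ‖v‖`   whenever `C₁ ≥ 2cLp`, `0 ≤ e ≤ ½`
  (the leak `≤ cLp√u‖v‖` since `Rτ ≤ 2` caps the exponential at `e^{E₁}` and `√|ℓ|²/(nν) ≤ √(u/D₀)`; then `mid_charge_fast`, `u/y = P/τ`,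
  `½·min 1 y ≤ dW`).  This is the `ε_ℓ ≤ alw·√(dW ℓ)` input of `VmodFlat.abs_inner_sub_le_sqrt_of_fast_modewise`.
`sorry`-free; NOT a proof of (fs), of the stub, of K1L_D or of AD; rung F-D1.A0.
-/

set_option linter.dupNamespace false

noncomputable section

namespace Summit.AnomalousDissipation.AnomalousDissipation.Theorems.SolenoidalFractalHomogenisation.LagrangianStep.VmodGen

open Set MeasureTheory Complex UnitAddTorus
open scoped InnerProductSpace ENNReal
open Literature.Analysis Literature.Analysis.FunctionSpaces Literature.Analysis.FunctionSpaces.Torus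
open Literature.Analysis.FluidPDE Literature.Analysis.FluidPDE.Torus Literature.Analysis.FluidPDE.LatticeShear
open Summit.AnomalousDissipation.AnomalousDissipation.Theorems.SolenoidalFractalHomogenisation.LagrangianStep.VmodFlat (fc fc_sub loT dW)

/-! ## §1 The scalar charge -/

/-- **The charge of the intermediate row**: `cLp·√u ≤ C₁·(u/y)^e·√(½·min 1 y)` for `2cLp ≤ C₁`, `0 < u ≤ y ≤ 2`, `e ≤ ½`
(`(u/y)^e ≥ √(u/y)` as `u/y ≤ 1`, and `½√y ≤ √(½ min 1 y)` as `y ≤ 2`). -/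
theorem mid_charge_fast {cLp C₁ u y e : ℝ} (hcLp : 0 ≤ cLp) (hC₁ : 2 * cLp ≤ C₁) (hu0 : 0 < u) (huy : u ≤ y) (hy2 : y ≤ 2)
    (he12 : e ≤ 1 / 2) :
    cLp * Real.sqrt u ≤ C₁ * (u / y) ^ e * Real.sqrt ((1 / 2) * min 1 y) := by
  have hy0 : 0 < y := lt_of_lt_of_le hu0 huy
  have huy0 : 0 < u / y := div_pos hu0 hy0
  have huy1 : u / y ≤ 1 := (div_le_one hy0).2 huy
  have h1 : Real.sqrt (u / y) ≤ (u / y) ^ e := by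
    rw [Real.sqrt_eq_rpow]
    exact Real.rpow_le_rpow_of_exponent_ge huy0 huy1 he12
  have h2 : (1 / 2) * Real.sqrt y ≤ Real.sqrt ((1 / 2) * min 1 y) := by
    have hm : y / 2 ≤ min 1 y := by
      rcases le_total y 1 with h | h
      · rw [min_eq_right h]; linarith
      · rw [min_eq_left h]; linarith
    have hpos : 0 ≤ (1 / 2) * Real.sqrt y := by positivity
    rw [show (1 / 2) * Real.sqrt y = Real.sqrt (((1 / 2) * Real.sqrt y) ^ 2) from (Real.sqrt_sq hpos).symm]
    apply Real.sqrt_le_sqrt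
    rw [mul_pow, Real.sq_sqrt hy0.le]
    linarith [hm]
  have h3 : Real.sqrt (u / y) * Real.sqrt y = Real.sqrt u := by
    rw [← Real.sqrt_mul huy0.le, div_mul_cancel₀ _ hy0.ne']
  have hC₁0 : 0 ≤ C₁ := by linarith
  calc cLp * Real.sqrt u = (2 * cLp) * (Real.sqrt (u / y) * ((1 / 2) * Real.sqrt y)) := by rw [← h3]; ring
    _ ≤ C₁ * ((u / y) ^ e * Real.sqrt ((1 / 2) * min 1 y)) :=
        mul_le_mul hC₁ (mul_le_mul h1 h2 (by positivity) (Real.rpow_nonneg huy0.le e)) (by positivity) hC₁0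
    _ = _ := by ring

/-! ## §2 The intermediate row -/

section Clause

variable {k : ℕ} {W : LatticeWord k} {M : ℝ} {hM : 0 < M} {c : ℝ} {lo hi Λ ν₀ K : ℝ}
  {ν : ℝ} {n : ℕ} {𝔸 : Visc4 (Fin 3)} {Tw : ℝ} {U : ℝ → ℝ → (V2 →L[ℝ] V2)}

set_option maxHeartbeats 1600000 in
/-- **THE INTERMEDIATE ROW FOR A FAST CLASS DATUM.**  See the module docstring. -/
theorem leak_le_alw_of_scale_mid_fast (hlo : 0 < lo) (hhi : 0 ≤ hi) (hΛ : 1 ≤ Λ) (hc : 0 < c)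
    (hν : ν ∈ Set.Ioo 0 ν₀) (hn : 1 ≤ n)
    (hwin : ∃ lam ∈ Set.Icc (1:ℝ) Λ, NearIso 𝔸 (ν * (lo / lam)) (ν * (hi * lam)))
    (hU : IsPropagator Tw (cellField W M hM ν hν.1 n) ((1 / (n:ℝ) ^ 2) • 𝔸) U)
    {s t : ℝ} (hs : 0 ≤ s) (hst : s < t) (htT : t ≤ Tw)
    (hphase : ∀ τ, cellField W M hM ν hν.1 n (s + τ) = cellField W M hM ν hν.1 n τ)
    {Lb : ℕ} (hLb : 2 * Lb < n) {ℓ : Fin 3 → ℤ} (hℓ0 : ℓ ≠ 0) (hℓL : ℓ ∈ Torus.freqBall (d := Fin 3) Lb)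
    (v : V2) (hv : v ∈ divFreeL2 (Fin 3))
    (hvcl : ∀ k', fc v k' ≠ 0 → (∀ i, (n : ℤ) ∣ k' i - ℓ i) ∨ (∀ i, (n : ℤ) ∣ k' i + ℓ i))
    (hv1 : fc v ℓ = 0) (hv2 : fc v (-ℓ) = 0)
    {C₁ e : ℝ}
    (hC₁c : 2 * (12 * k * Real.exp (9 * (k : ℝ) ^ 2 / (2 * Real.pi ^ 4 * (lo / Λ) ^ 2 * c))
        / (Real.pi ^ 2 * (lo / Λ) * Real.sqrt (8 * Real.pi ^ 2 * (lo / Λ) * (M * W.period) * c))) ≤ C₁)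
    (he12 : e ≤ 1 / 2)
    (hRP : 8 * Real.pi ^ 2 * loT lo Λ c ν n * Torus.freqNormSq ℓ * (M * W.period / ν) ≤ 1)
    (hτP : M * W.period / ν ≤ t - s)
    (hRτ : 8 * Real.pi ^ 2 * loT lo Λ c ν n * Torus.freqNormSq ℓ * (t - s) ≤ 2) :
    ‖fc (U s t v) ℓ‖
      ≤ (C₁ * (C₁ * (ν ^ e + ((⌈K / ν⌉₊ : ℝ) / n) ^ e) + (min 1 ((M * W.period / ν) / (t - s))) ^ e))
        * Real.sqrt (dW lo Λ c ν n (t - s) ℓ) * ‖v‖ := by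
  classical
  -- ### scalars
  have hτ0 : 0 < t - s := by linarith
  have hsT : s < Tw := lt_of_lt_of_le hst htT
  have hnpos : 0 < n := hn
  have hn1 : n ≠ 0 := Nat.pos_iff_ne_zero.1 hnpos
  have hn0 : (0:ℝ) < n := by exact_mod_cast hnpos
  have hΛ0 : 0 < Λ := lt_of_lt_of_le one_pos hΛ
  have hloΛ : 0 < lo / Λ := div_pos hlo hΛ0
  have hloA : 0 < ν * (lo / Λ) := mul_pos hν.1 hloΛ
  have hWp := PermissibleCarrier.period_pos W
  have hMW : 0 < M * W.period := mul_pos hM hWp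
  have hL0 : 0 < ‖Torus.latticeVec ℓ‖ := by
    refine norm_pos_iff.2 fun h => hℓ0 ?_
    funext i
    have hi := congrArg (fun w : EuclideanSpace ℝ (Fin 3) => w i) h
    simpa [Torus.latticeVec_apply] using hi
  set q : ℝ := Torus.freqNormSq ℓ with hq
  have hq0 : 0 < q := by rw [hq, ← norm_latticeVec_sq_eq]; positivity
  set P : ℝ := M * W.period / ν with hP
  have hP0 : 0 < P := div_pos hMW hν.1
  set R : ℝ := 8 * Real.pi ^ 2 * loT lo Λ c ν n * q with hR
  have hu1 : R * P ≤ 1 := hRP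
  have hRτ2 : R * (t - s) ≤ 2 := hRτ
  have hR0 : 0 < R := by
    rw [hR]; unfold loT
    have hνc : 0 < ν + c / ν := by have := hν.1; positivity
    positivity
  set u : ℝ := R * P with hu
  have hu0 : 0 < u := mul_pos hR0 hP0
  set y : ℝ := R * (t - s) with hy
  have hy0 : 0 < y := mul_pos hR0 hτ0
  have huy : u ≤ y := mul_le_mul_of_nonneg_left hτP hR0.le
  have hτR : t - s ≤ 2 / R := by rw [le_div_iff₀ hR0]; linarith
  -- `2|ℓ| < n` from the ball
  have hℓn : 2 * Real.sqrt (freqNormSq ℓ) < n := by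
    have h2 := hℓL
    rw [Torus.mem_freqBall] at h2
    have hsq : Real.sqrt (freqNormSq ℓ) ≤ Lb := by
      rw [← Real.sqrt_sq (Nat.cast_nonneg Lb)]; exact Real.sqrt_le_sqrt h2
    have : (2:ℝ) * Lb < n := by exact_mod_cast hLb
    linarith
  -- ### the leak lemma along the stretched word
  have hAΛ : NearIso 𝔸 (ν * (lo / Λ)) (ν * (hi * Λ)) := by
    obtain ⟨lam, hlam, hA⟩ := hwin
    have hlam1 : 0 < lam := lt_of_lt_of_le one_pos hlam.1
    exact hA.mono (mul_le_mul_of_nonneg_left (div_le_div_of_nonneg_left hlo.le hlam1 hlam.2) hν.1.le)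
      (mul_le_mul_of_nonneg_left (mul_le_mul_of_nonneg_left hlam.2 hhi) hν.1.le)
  set W₁ : LatticeWord k := (W.stretch M hM).stretch (1 / ν) (one_div_pos.mpr hν.1) with hW₁
  have hU' : IsPropagator Tw (W₁.cell n) ((1 / (n:ℝ) ^ 2) • 𝔸) U := hU
  have hphase' : ∀ τ, W₁.cell n (s + τ) = W₁.cell n τ := hphase
  have hlk := norm_fc_slow_le_of_fast W₁ hn1 hAΛ hloA hU' hs hst.le htT hsT hphase' hℓ0 hℓn v ((mem_divFreeL2_iff v).1 hv)
    hvcl hv1 hv2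
  -- ### envelopes: exponent `≤ E₁`, prefactor `≤ cLp√u / e^{E₁}`
  set D₀ : ℝ := 8 * Real.pi ^ 2 * (lo / Λ) * (M * W.period) * c with hD₀
  set E₁ : ℝ := 9 * (k : ℝ) ^ 2 / (2 * Real.pi ^ 4 * (lo / Λ) ^ 2 * c) with hE₁
  have hD₀0 : 0 < D₀ := by rw [hD₀]; positivity
  set cL : ℝ := (12 * k * (Real.sqrt q / n) / (Real.pi ^ 2 * (ν * (lo / Λ)))) *
      Real.exp (18 * (k : ℝ) ^ 2 * (q / (n : ℝ) ^ 2) * (t - s) / (Real.pi ^ 2 * (ν * (lo / Λ)))) with hcL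
  set cLs : ℝ := (12 * k * (Real.sqrt q / n) / (Real.pi ^ 2 * (ν * (lo / Λ)))) * Real.exp E₁ with hcLs
  set cLp : ℝ := 12 * k * Real.exp E₁ / (Real.pi ^ 2 * (lo / Λ) * Real.sqrt D₀) with hcLp
  have hcLp0 : 0 ≤ cLp := by rw [hcLp]; positivity
  have hlk' : ‖fc (U s t v) ℓ‖ ≤ cL * ‖v‖ := by rw [hcL]; exact hlk
  have hcLs_le : cL ≤ cLs := by
    rw [hcL, hcLs]
    refine mul_le_mul_of_nonneg_left (Real.exp_le_exp.2 ?_) (by positivity)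
    have h1 : 18 * (k : ℝ) ^ 2 * (q / (n : ℝ) ^ 2) * (t - s) / (Real.pi ^ 2 * (ν * (lo / Λ)))
        ≤ 18 * (k : ℝ) ^ 2 * (q / (n : ℝ) ^ 2) * (2 / R) / (Real.pi ^ 2 * (ν * (lo / Λ))) :=
      div_le_div_of_nonneg_right (mul_le_mul_of_nonneg_left hτR (by positivity)) (by positivity)
    refine h1.trans ?_
    have e2 : 18 * (k : ℝ) ^ 2 * (q / (n : ℝ) ^ 2) * (2 / R) / (Real.pi ^ 2 * (ν * (lo / Λ)))
        = 9 * (k : ℝ) ^ 2 / (2 * Real.pi ^ 4 * (lo / Λ) ^ 2 * (ν ^ 2 + c)) := by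
      rw [hR]; unfold loT
      have hνc : ν ^ 2 + c ≠ 0 := by have := hν.1; positivity
      have hνne : ν ≠ 0 := hν.1.ne'
      field_simp
      ring
    rw [e2, hE₁]
    refine div_le_div_of_nonneg_left (by positivity) (by positivity) ?_
    refine mul_le_mul_of_nonneg_left ?_ (by positivity)
    nlinarith [hν.1]
  have hcL_le : cL ≤ cLp * Real.sqrt u := by
    refine hcLs_le.trans ?_
    have hsq : q / ((n:ℝ) ^ 2 * ν ^ 2) ≤ u / D₀ := by
      rw [le_div_iff₀ hD₀0]
      have h := RP_ge (c := c) hloΛ.le hMW.le hν.1 hn ℓ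
      rw [← hq] at h
      calc q / ((n:ℝ) ^ 2 * ν ^ 2) * D₀ = 8 * Real.pi ^ 2 * (lo / Λ) * (M * W.period) * c * (q / ((n:ℝ) ^ 2 * ν ^ 2)) := by
            rw [hD₀]; ring
        _ ≤ u := h
    have hsq2 : Real.sqrt q / (n * ν) ≤ Real.sqrt u / Real.sqrt D₀ := by
      have hnν : 0 < (n:ℝ) * ν := mul_pos hn0 hν.1
      have eL : Real.sqrt q / (n * ν) = Real.sqrt (q / ((n:ℝ) * ν) ^ 2) := by
        rw [Real.sqrt_div hq0.le, Real.sqrt_sq hnν.le]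
      have eR : Real.sqrt u / Real.sqrt D₀ = Real.sqrt (u / D₀) := by rw [Real.sqrt_div hu0.le]
      rw [eL, eR]
      refine Real.sqrt_le_sqrt ?_
      rw [show ((n:ℝ) * ν) ^ 2 = (n:ℝ) ^ 2 * ν ^ 2 by ring]
      exact hsq
    have e1 : cLs = (12 * k * Real.exp E₁ / (Real.pi ^ 2 * (lo / Λ))) * (Real.sqrt q / (n * ν)) := by
      rw [hcLs]; field_simp
    have e2 : cLp * Real.sqrt u = (12 * k * Real.exp E₁ / (Real.pi ^ 2 * (lo / Λ))) * (Real.sqrt u / Real.sqrt D₀) := by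
      rw [hcLp]; field_simp
    rw [e1, e2]
    exact mul_le_mul_of_nonneg_left hsq2 (by positivity)
  -- ### the charge and the currency
  have hC₁c' : 2 * cLp ≤ C₁ := by rw [hcLp, hE₁, hD₀]; exact hC₁c
  have hC₁0 : 0 ≤ C₁ := by linarith
  have hcharge := mid_charge_fast hcLp0 hC₁c' hu0 huy hRτ2 he12
  have huy_eq : u / y = P / (t - s) := by
    rw [hu, hy, mul_div_mul_left _ _ hR0.ne']
  have hy1' : P / (t - s) ≤ 1 := (div_le_one hτ0).2 hτP
  have hmin : min 1 (M * W.period / ν / (t - s)) = P / (t - s) := by rw [← hP]; exact min_eq_right hy1'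
  have hdW : (1 / 2) * min 1 y ≤ dW lo Λ c ν n (t - s) ℓ := by
    have h := one_sub_exp_neg_ge hy0.le
    unfold dW; rw [← hq]
    have e : 8 * Real.pi ^ 2 * loT lo Λ c ν n * q * (t - s) = y := by rw [hy, hR]
    rw [e]; exact h
  have hνe0 : 0 ≤ ν ^ e := Real.rpow_nonneg hν.1.le e
  have hue : 0 ≤ ((⌈K / ν⌉₊ : ℝ) / n) ^ e := Real.rpow_nonneg (by positivity) e
  have hPe0 : 0 ≤ (P / (t - s)) ^ e := Real.rpow_nonneg (by positivity) e
  have halw : C₁ * (u / y) ^ e ≤ C₁ * (C₁ * (ν ^ e + ((⌈K / ν⌉₊ : ℝ) / n) ^ e) + (min 1 ((M * W.period / ν) / (t - s))) ^ e) := by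
    rw [hmin, huy_eq]
    have : 0 ≤ C₁ * (ν ^ e + ((⌈K / ν⌉₊ : ℝ) / n) ^ e) := by positivity
    nlinarith
  have hv0 := norm_nonneg v
  calc ‖fc (U s t v) ℓ‖ ≤ cL * ‖v‖ := hlk'
    _ ≤ cLp * Real.sqrt u * ‖v‖ := mul_le_mul_of_nonneg_right hcL_le hv0
    _ ≤ C₁ * (u / y) ^ e * Real.sqrt ((1 / 2) * min 1 y) * ‖v‖ := mul_le_mul_of_nonneg_right hcharge hv0
    _ ≤ (C₁ * (C₁ * (ν ^ e + ((⌈K / ν⌉₊ : ℝ) / n) ^ e) + (min 1 ((M * W.period / ν) / (t - s))) ^ e))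
        * Real.sqrt (dW lo Λ c ν n (t - s) ℓ) * ‖v‖ := by
        refine mul_le_mul_of_nonneg_right ?_ hv0
        exact mul_le_mul halw (Real.sqrt_le_sqrt hdW) (Real.sqrt_nonneg _) (by positivity)

end Clause

end Summit.AnomalousDissipation.AnomalousDissipation.Theorems.SolenoidalFractalHomogenisation.LagrangianStep.VmodGen

end
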